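/-
Copyright: lit-balaban Phase-2 proof seat p31 (gen 3).  Statement-level skeleton of a published paper; no proof claims beyond what the
kernel checks below.
-/
import Literature.MathematicalPhysics.QuantumFieldTheory.BalabanImbrieJaffe1984to88.BIJ85Eq224ProofPart2
import Literature.MathematicalPhysics.QuantumFieldTheory.BalabanImbrieJaffe1984to88.BIJ85SmallFieldSplit64

/-!
# `BalabanImbrieJaffe1984to88.BIJ85Eq453GaugeField` — T. Bałaban, J. Imbrie, A. Jaffe, *Renormalization of the Higgs model: minimizers,
propagators and the stability of mean field theory*, Commun. Math. Phys. **97** (1985) 299–329 [BalabanImbrieJaffe1985]: the pull-back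
**(4.5.3)** `Q^{s*}_k` of GROUP-VALUED configurations, for an ARBITRARY group of values, on the tori — with its plaquette variables
(the nonabelian form of `(Q^{s*}_kV)(∂p) = V(∂p′)`)

statement-level skeleton of published theorems with citation tags; proofs where landed; nothing here is a claim about the Yang–Mills mass gap

PDF held: `paper:balaban1985-cmp97-bij-higgs-minimizers` (journal page = PDF page + 298).  Pages read as images:
`run/shared/lean/pub/lit-balaban/lit-balaban-r15/pages/1985-cmp97-bij-higgs-minimizers-p014-x2.png` (p. 312); [Balaban1988Convergent]
p. 246 (1.3) quoted from the typed row `Balaban1983to89.B14Sect1Repr` (reader r11), render cited there.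

CITATION HEADER (lean-in-tree rule).  Part of the lit-balaban TYPED SKELETON (HOME `run/shared/lean/pub/lit-balaban/`), Phase-2 seat p31
(gen 3); rows **C1.Eq4.5.3** (typed/proved for U(1): `BIJ85Sect2SurfaceAverages.BlockBonds.QsstarGroup`, `eq453_interior`, `eq453_corridor`)
and **B14.Eq1.3** ([Balaban1988Convergent] (1.3), which *recalls* (4.5.3) for the gauge group of that series; so far only the abstract datum
`B14Sect1Repr.Sect1Data.Qsstar : GaugeField P 1 G → GaugeField P 0 G`) of `HOME/SKELETON.md`.

THE PRINTED TEXT (verbatim).  p. 312 [PDF 14]: *"To begin, we have to define a transformation Q^{s*}_k from unit-lattice, group-valued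
configurations v to η-lattice, group-valued configurations. … The independence of the resulting transformation on this choice follows
from the equivalent definition: (Q^{s*}_kv)_b = 1 if b is strictly contained in a k-block (both endpoints belong to the block), v_c if the
η-lattice bond b belongs to the corridor of bonds connecting the two blocks B^k(c₋) and B^k(c₊). Here c is a unit lattice bond.
(4.5.3)"*; [Balaban1988Convergent] p. 246 [PDF 4]: *"Let us recall the definition (Q₁^{s*}V)(b) = 1 for b ⊂ B(y), y ∈ T^{(1)}; = V(c)
for b ∈ B(c) = {b : b₋ ∈ B(c₋), b₊ ∈ B(c₊)}, c ∈ T^{(1)}. (1.3)"*.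

WHAT IS REPRODUCED, and how.  (4.5.3) is a definition by cases that makes sense for configurations with values in ANY group (no
logarithm, no commutativity); here it is DEFINED on the tori of `Balaban1983to89.Setup` for `GaugeField P j G = PBond P j → G` with an
arbitrary value type `G` carrying a `1`: one step `qsstarG : GaugeField P (j+1) G → GaugeField P j G` (`(Q^{s*}V)(b) = 1` if
`blockOf b₊ = blockOf b₋`, else `V⟨blockOf b₋, μ⟩` — the corridor through `b` joins `B(blockOf b₋)` to `B(blockOf b₋ + e_μ)`,
`BIJ85Eq219Proof.blockOf_tgt`) and the k-fold composite `qsstarGIter k : GaugeField P (i+k) G → GaugeField P i G` (`Q^{s*}_{k+1} =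
Q^{s*}_kQ^{s*}`).  PROVED: (i) the two printed cases, with "b strictly inside a k-block" = `blockOfIter k b₋ = blockOfIter k b₊` and "b in
the corridor of c" = `b ∈ B^s_k(c)` of the torus geometries `BIJ85Eq219Proof.torusBlockBonds` / `BIJ85Eq224Proof.torusBlockBondsIter`
(`qsstarG_of_interior`, `qsstarG_of_mem`, `qsstarGIter_eq`, `qsstarGIter_of_interior`, `qsstarGIter_of_mem`) — so (4.5.3) with k-blocks IS
the k-fold composite of the one-step pull-backs; (ii) THE PLAQUETTE VARIABLES for a `GaugeGroup G` (`Setup.GaugeField.plaqHol`, any —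
in particular nonabelian — such group): `(Q^{s*}V)(∂p) = V(∂p′)` for an edge plaquette `p ∈ B^e(p′)` (`BIJ85CurlQsstar.torusEdgeCells`)
and `= 1` on every other plaquette (interior plaquettes carry only `1`'s; a plaquette crossing one corridor carries `V(c)·V(c)⁻¹` around
two `1`'s) (`plaqHol_qsstarG_of_mem`, `plaqHol_qsstarG_of_not_mem`), and the same for `Q^{s*}_k` and `B^e_k(p′)`
(`BIJ85Eq224ProofPart2.torusEdgeCellsIter`; `plaqHol_qsstarGIter_of_mem`, `…_of_not_mem`); (iii) the U(1) DICTIONARY: for `v = exp(ieB)` the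
field (4.5.2) `exp(ieη(Q^{s*}B))` (`BIJ85SmallFieldSplit64.expField`, values `BlockBonds.QsstarGroup`) IS `qsstarG v` when `ηL = 1`
(`expField_Qsstar_eq_qsstarG`; k-fold `expField_QsstarIter_eq_qsstarGIter` with `ηL^k = 1`) — the printed "independence of the branch";
(iv) THE SECTION PROPERTY for the series' straight-line (decimation) average `Balaban1983to89.AveragingRT.axialAvg` / `Setup.Averaging.iter`:
**`M(Q^{s*}V) = V`** and **`M^k(Q^{s*}_kV) = V`** (`axialAvg_qsstarG`, `iter_axial_qsstarGIter0` for the base-0 composite `qsstarGIter0`) — the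
pulled-back configuration has the prescribed averages (the group-valued counterpart, for this average, of (2.19) `QQ^{s*} = I`);
(v) GAUGE COVARIANCE `Q^{s*}_k(V^g) = (Q^{s*}_kV)^{g∘B^k}` (`qsstarG_gaugeAct`, `qsstarGIter_gaugeAct`) — the mechanism of the induced
block-field gauge transformations of [BalabanImbrieJaffe1988] (4.16)–(4.17).
Standing range `j + 1 ≤ m + K` / `i + k ≤ m + K`; `2 ≤ d` for the edge-plaquette carrier.  NOTHING beyond the kernel-checked statements is
asserted.  Unit `lit-balaban-p31` (literature-prover-lit-balaban-p31-g3-0), 2026-08-21.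
-/

open scoped BigOperators

namespace Literature.MathematicalPhysics.QuantumFieldTheory.BalabanImbrieJaffe1984to88.BIJ85Eq453GaugeField

open Literature.MathematicalPhysics.QuantumFieldTheory.Balaban1983to89
open BIJ85Sect2SurfaceAverages BIJ85CellAverages LatticeFieldCalculus BIJ85Eq219Proof BIJ85CurlQsstar BIJ85Eq224Proof
  BIJ85Eq224ProofPart2 BIJ85Sect1Model BIJ85SmallFieldSplit64 B7SectAStatements

variable {P : Params} {i j : ℕ} {G : Type*}

/-! ## 0. Torus bookkeeping -/

/-- `y + e_μ ≠ y` on every torus of the series. [folklore] -/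
private theorem shift_ne_self {k : ℕ} (y : Balaban1983to89.Site P k) (μ : Fin P.d) : y.shift μ ≠ y := by
  intro h
  have h1 := congrFun h μ
  simp only [Balaban1983to89.Site.shift, Function.update_self] at h1
  exact one_ne_zero (add_eq_left.1 h1)

/-- `y + e_μ = y + e_ν` forces `μ = ν` (standing range not needed beyond `2 < sitesPerDir`; here from `1 ≠ 0`, `1 ≠ -…`: we use the
coordinate `μ`). [folklore] -/
private theorem dir_eq_of_shift_eq {k : ℕ} (y : Balaban1983to89.Site P k) {μ ν : Fin P.d} (h : y.shift μ = y.shift ν) : μ = ν := by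
  by_contra hne
  have h1 := congrFun h μ
  simp only [Balaban1983to89.Site.shift, Function.update_self, Function.update_of_ne hne] at h1
  exact one_ne_zero (add_eq_left.1 h1)

/-- Every fine site is a `blockSite` of its block (standing range). [folklore] -/
private theorem exists_eq_blockSite (hj : j + 1 ≤ P.m + P.K) (x : Balaban1983to89.Site P j) :
    ∃ r : Fin P.d → Fin P.L, x = Balaban1983to89.Site.blockSite (blockOf x) r := by
  refine ⟨Balaban1983to89.Site.blockEquiv hj (blockOf x) ⟨x, rfl⟩, ?_⟩
  have h := (Balaban1983to89.Site.blockEquiv hj (blockOf x)).symm_apply_apply ⟨x, rfl⟩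
  exact (congrArg Subtype.val h).symm

/-! ## 1. (4.5.3), one step: the pull-back `Q^{s*}` of group-valued configurations -/

/-- **(4.5.3)** p. 312 [PDF 14] at one step (`k = 1`; = [Balaban1988Convergent] (1.3) p. 246), for configurations with values in an arbitrary
type `G` with a unit: `(Q^{s*}V)(b) = 1` if the bond `b` of `T^{(j)}` lies strictly inside a block (`blockOf b₊ = blockOf b₋`), and `= V(c)`
if `b` lies in the corridor `B^s(c)` — that corridor joins `B(blockOf b₋)` to `B(blockOf b₋ + e_μ)`, `μ` the direction of `b`, so
`c = ⟨blockOf b₋, μ⟩` (`qsstarG_of_mem`). [cite: BalabanImbrieJaffe1985, (4.5.3) p.312] -/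
def qsstarG [One G] (V : GaugeField P (j + 1) G) : GaugeField P j G :=
  fun b => if blockOf b.tgt = blockOf b.src then 1 else V ⟨blockOf b.src, b.dir⟩

/-- kernel, unfolding. [cite: BalabanImbrieJaffe1985, (4.5.3) p.312] -/
theorem qsstarG_apply [One G] (V : GaugeField P (j + 1) G) (b : PBond P j) :
    qsstarG V b = if blockOf b.tgt = blockOf b.src then 1 else V ⟨blockOf b.src, b.dir⟩ := rfl

/-- **(4.5.3)**, first case, verbatim: *"(Q^{s*}_kv)_b = 1 if b is strictly contained in a k-block (both endpoints belong to the block)"*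
(k = 1). [cite: BalabanImbrieJaffe1985, (4.5.3) p.312] -/
theorem qsstarG_of_interior [One G] (V : GaugeField P (j + 1) G) {b : PBond P j} (hb : blockOf b.src = blockOf b.tgt) :
    qsstarG V b = 1 := by
  rw [qsstarG_apply, if_pos hb.symm]

/-- kernel: a corridor bond `b ∈ B^s(c)` has `c = ⟨blockOf b₋, μ⟩` and is not interior (standing range).
[cite: BalabanImbrieJaffe1985, (2.15) p.304] -/
theorem eq_of_mem_Bs (hj : j + 1 ≤ P.m + P.K) {b : PBond P j} {c : PBond P (j + 1)} (h : b ∈ (torusBlockBonds P j).Bs c) :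
    c = ⟨blockOf b.src, b.dir⟩ ∧ blockOf b.tgt ≠ blockOf b.src := by
  rw [mem_Bs_iff] at h
  obtain ⟨h1, h2⟩ := h
  have hne : blockOf b.tgt ≠ blockOf b.src := by
    rw [h1, h2]
    exact (shift_ne_self c.src c.dir)
  refine ⟨?_, hne⟩
  rcases blockOf_tgt hj b with h | h
  · exact absurd h hne
  · rcases c with ⟨s, μ⟩
    simp only at h1 h2
    subst h1
    have hμ : μ = b.dir := dir_eq_of_shift_eq _ (h2.symm.trans h)
    subst hμ
    rfl

/-- **(4.5.3)**, second case, verbatim: *"(Q^{s*}_kv)_b = v_c if the η-lattice bond b belongs to the corridor of bonds connecting the two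
blocks B^k(c₋) and B^k(c₊). Here c is a unit lattice bond."* (k = 1; corridor = `B^s(c)` of `BIJ85Eq219Proof.torusBlockBonds`; standing
range). [cite: BalabanImbrieJaffe1985, (4.5.3) p.312] -/
theorem qsstarG_of_mem [One G] (hj : j + 1 ≤ P.m + P.K) (V : GaugeField P (j + 1) G) {b : PBond P j} {c : PBond P (j + 1)}
    (h : b ∈ (torusBlockBonds P j).Bs c) : qsstarG V b = V c := by
  obtain ⟨rfl, hne⟩ := eq_of_mem_Bs hj h
  rw [qsstarG_apply, if_neg hne]

/-- kernel: a non-interior bond lies in the corridor of `⟨blockOf b₋, μ⟩` (standing range). [cite: BalabanImbrieJaffe1985, (2.15) p.304] -/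
theorem mem_Bs_of_not_interior (hj : j + 1 ≤ P.m + P.K) {b : PBond P j} (hb : blockOf b.tgt ≠ blockOf b.src) :
    b ∈ (torusBlockBonds P j).Bs ⟨blockOf b.src, b.dir⟩ := by
  rw [mem_Bs_iff]
  rcases blockOf_tgt hj b with h | h
  · exact absurd h hb
  · exact ⟨rfl, h⟩

/-- kernel: the value of `Q^{s*}V` on the bond `⟨x, x + e_μ⟩`, `x = blockSite y r ∈ B(y)`: `V⟨y, μ⟩` if `r_μ = L − 1` (a corridor bond), `1`
otherwise (standing range). [cite: BalabanImbrieJaffe1985, (4.5.3) p.312] -/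
theorem qsstarG_blockSite [One G] (hj : j + 1 ≤ P.m + P.K) (V : GaugeField P (j + 1) G) (y : Balaban1983to89.Site P (j + 1))
    (r : Fin P.d → Fin P.L) (μ : Fin P.d) :
    qsstarG V ⟨Balaban1983to89.Site.blockSite y r, μ⟩ = if (r μ : ℕ) + 1 = P.L then V ⟨y, μ⟩ else 1 := by
  rw [qsstarG_apply]
  change (if blockOf ((Balaban1983to89.Site.blockSite y r).shift μ) = blockOf (Balaban1983to89.Site.blockSite y r) then (1 : G)
    else V ⟨blockOf (Balaban1983to89.Site.blockSite y r), μ⟩) = _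
  rw [blockOf_shift_blockSite hj, Balaban1983to89.Site.blockOf_blockSite hj]
  by_cases h : (r μ : ℕ) + 1 = P.L
  · rw [if_pos h, if_neg (shift_ne_self y μ), if_pos h]
  · rw [if_neg h, if_pos rfl, if_neg h]

/-- kernel: the value of `Q^{s*}V` on `⟨x + e_μ, ν⟩`, `ν ≠ μ`, when `x + e_μ` stays in `B(y)` (`r_μ + 1 < L`): `V⟨y, ν⟩` if `r_ν = L − 1`, else `1`
(standing range). [cite: BalabanImbrieJaffe1985, (4.5.3) p.312] -/
theorem qsstarG_shift_blockSite_of_lt [One G] (hj : j + 1 ≤ P.m + P.K) (V : GaugeField P (j + 1) G)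
    (y : Balaban1983to89.Site P (j + 1)) (r : Fin P.d → Fin P.L) {μ ν : Fin P.d} (hne : ν ≠ μ) (hμ : (r μ : ℕ) + 1 < P.L) :
    qsstarG V ⟨(Balaban1983to89.Site.blockSite y r).shift μ, ν⟩ = if (r ν : ℕ) + 1 = P.L then V ⟨y, ν⟩ else 1 := by
  rw [shift_blockSite_of_lt y r μ hμ, qsstarG_blockSite hj, Function.update_of_ne hne]

/-- kernel: the value of `Q^{s*}V` on `⟨x + e_μ, ν⟩`, `ν ≠ μ`, when `x + e_μ` has left `B(y)` (`r_μ + 1 = L`): `V⟨y + e_μ, ν⟩` if `r_ν = L − 1`,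
else `1` (standing range). [cite: BalabanImbrieJaffe1985, (4.5.3) p.312] -/
theorem qsstarG_shift_blockSite_of_eq [One G] (hj : j + 1 ≤ P.m + P.K) (V : GaugeField P (j + 1) G)
    (y : Balaban1983to89.Site P (j + 1)) (r : Fin P.d → Fin P.L) {μ ν : Fin P.d} (hne : ν ≠ μ) (hμ : (r μ : ℕ) + 1 = P.L) :
    qsstarG V ⟨(Balaban1983to89.Site.blockSite y r).shift μ, ν⟩ = if (r ν : ℕ) + 1 = P.L then V ⟨y.shift μ, ν⟩ else 1 := by
  rw [shift_blockSite_of_eq hj y r μ hμ, qsstarG_blockSite hj, Function.update_of_ne hne]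

/-! ## 2. The plaquette variables of `Q^{s*}V` for a (possibly nonabelian) gauge group -/

/-- THE PLAQUETTE VARIABLES OF THE PULL-BACK, on each plaquette (any `GaugeGroup G`, any `d`): for `p = ⟨x, μ, ν⟩`, `x = blockSite y r`,
`(Q^{s*}V)(∂p) = V(∂⟨y, μ, ν⟩)` when `r_μ = r_ν = L − 1` (the four bonds of `p` are corridor bonds of the four bonds of `⟨y, μ, ν⟩`), and
`= 1` otherwise (only `1`'s, or `V(c)·1·V(c)⁻¹·1` across one corridor) (standing range). [cite: BalabanImbrieJaffe1985, (4.5.3) p.312] -/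
theorem plaqHol_qsstarG_blockSite [GaugeGroup G] (hj : j + 1 ≤ P.m + P.K) (V : GaugeField P (j + 1) G)
    (y : Balaban1983to89.Site P (j + 1)) (r : Fin P.d → Fin P.L) {μ ν : Fin P.d} (hμν : μ < ν) :
    GaugeField.plaqHol (qsstarG V) ⟨Balaban1983to89.Site.blockSite y r, μ, ν, hμν⟩ =
      if (r μ : ℕ) + 1 = P.L ∧ (r ν : ℕ) + 1 = P.L then GaugeField.plaqHol V ⟨y, μ, ν, hμν⟩ else 1 := by
  have hne : μ ≠ ν := ne_of_lt hμν
  have hrμ := (r μ).isLt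
  have hrν := (r ν).isLt
  simp only [GaugeField.plaqHol]
  rw [qsstarG_blockSite hj V y r μ, qsstarG_blockSite hj V y r ν]
  by_cases hμ : (r μ : ℕ) + 1 = P.L <;> by_cases hν : (r ν : ℕ) + 1 = P.L
  · rw [qsstarG_shift_blockSite_of_eq hj V y r hne.symm hμ, qsstarG_shift_blockSite_of_eq hj V y r hne hν]
    simp only [hμ, hν, and_self, if_true]
  · rw [qsstarG_shift_blockSite_of_eq hj V y r hne.symm hμ, qsstarG_shift_blockSite_of_lt hj V y r hne (by omega)]
    simp only [hμ, hν, and_false, if_false, if_true, mul_one, mul_inv_cancel]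
  · rw [qsstarG_shift_blockSite_of_lt hj V y r hne.symm (by omega), qsstarG_shift_blockSite_of_eq hj V y r hne hν]
    simp only [hμ, hν, false_and, if_false, if_true, one_mul, inv_one, mul_one, mul_inv_cancel]
  · rw [qsstarG_shift_blockSite_of_lt hj V y r hne.symm (by omega), qsstarG_shift_blockSite_of_lt hj V y r hne (by omega)]
    simp only [hμ, hν, and_self, if_false, inv_one, mul_one]

/-- **`(Q^{s*}V)(∂p) = V(∂p′)` for `p ∈ B^e(p′)`** — the plaquette variable of the pull-back (4.5.3) on an edge plaquette of `p′`
(`BIJ85CurlQsstar.torusEdgeCells`) is the coarse plaquette variable, for ANY gauge group (standing range, `2 ≤ d`).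
[cite: BalabanImbrieJaffe1985, (4.5.3) p.312] -/
theorem plaqHol_qsstarG_of_mem [GaugeGroup G] (hj : j + 1 ≤ P.m + P.K) (hd : 2 ≤ P.d) (V : GaugeField P (j + 1) G)
    {p : Plaq P j} {p' : Plaq P (j + 1)} (h : p ∈ (torusEdgeCells P j hd).B p') :
    GaugeField.plaqHol (qsstarG V) p = GaugeField.plaqHol V p' := by
  obtain ⟨x, μ, ν, hμν⟩ := p
  obtain ⟨r, hr⟩ := exists_eq_blockSite hj x
  rw [hr] at h ⊢
  obtain ⟨rfl, hμ, hν⟩ := (mem_edgeB_blockSite_iff hj hd p' (blockOf x) r hμν).mp h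
  rw [plaqHol_qsstarG_blockSite hj V (blockOf x) r hμν, if_pos ⟨hμ, hν⟩]

/-- … and `(Q^{s*}V)(∂p) = 1` on every plaquette that is not an edge plaquette (standing range, `2 ≤ d`).
[cite: BalabanImbrieJaffe1985, (4.5.3) p.312] -/
theorem plaqHol_qsstarG_of_not_mem [GaugeGroup G] (hj : j + 1 ≤ P.m + P.K) (hd : 2 ≤ P.d) (V : GaugeField P (j + 1) G)
    {p : Plaq P j} (h : ∀ p', p ∉ (torusEdgeCells P j hd).B p') :
    GaugeField.plaqHol (qsstarG V) p = 1 := by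
  obtain ⟨x, μ, ν, hμν⟩ := p
  obtain ⟨r, hr⟩ := exists_eq_blockSite hj x
  rw [hr] at h ⊢
  rw [plaqHol_qsstarG_blockSite hj V (blockOf x) r hμν, if_neg]
  intro hc
  exact h _ ((mem_edgeB_blockSite_iff hj hd _ (blockOf x) r hμν).mpr ⟨rfl, hc.1, hc.2⟩)

/-! ## 3. (4.5.3) with k-blocks: the k-fold composite -/

/-- **(4.5.3)** with k-blocks as the k-fold COMPOSITE of the one-step pull-backs, `Q^{s*}_{k+1} = Q^{s*}_kQ^{s*}` (the last factor from
`T^{(i+k+1)}` to `T^{(i+k)}`): `GaugeField P (i+k) G → GaugeField P i G`. [cite: BalabanImbrieJaffe1985, (4.5.3) p.312] -/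
def qsstarGIter [One G] : (k : ℕ) → GaugeField P (i + k) G → GaugeField P i G
  | 0 => id
  | k + 1 => fun V => qsstarGIter k (qsstarG V)

/-- `Q^{s*}_0 = I`. [cite: BalabanImbrieJaffe1985, (4.5.3) p.312] -/
@[simp] theorem qsstarGIter_zero [One G] (V : GaugeField P (i + 0) G) : qsstarGIter 0 V = V := rfl

/-- `Q^{s*}_{k+1}V = Q^{s*}_k(Q^{s*}V)`. [cite: BalabanImbrieJaffe1985, (4.5.3) p.312] -/
theorem qsstarGIter_succ [One G] (k : ℕ) (V : GaugeField P (i + k + 1) G) :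
    qsstarGIter (k + 1) V = qsstarGIter k (qsstarG V) := rfl

/-- **(4.5.3)** verbatim for k-blocks: the composite IS the printed case formula — `(Q^{s*}_kV)(b) = 1` if `b` lies strictly inside a
k-block (`blockOfIter k b₊ = blockOfIter k b₋`), else `V(c)` with `c = ⟨blockOfIter k b₋, μ⟩` the unit-lattice bond whose corridor
contains `b` (standing range). [cite: BalabanImbrieJaffe1985, (4.5.3) p.312] -/
theorem qsstarGIter_eq [One G] : ∀ (k : ℕ), i + k ≤ P.m + P.K → ∀ (V : GaugeField P (i + k) G) (b : PBond P i),
    qsstarGIter k V b = if blockOfIter k b.tgt = blockOfIter k b.src then 1 else V ⟨blockOfIter k b.src, b.dir⟩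
  | 0, _, V, b => by
    have h : b.tgt ≠ b.src := shift_ne_self b.src b.dir
    simp only [qsstarGIter_zero, blockOfIter_zero, if_neg h]
    rfl
  | k + 1, hk, V, b => by
    rw [qsstarGIter_succ, qsstarGIter_eq k (by omega) (qsstarG V) b]
    simp only [blockOfIter_succ]
    by_cases h : blockOfIter k b.tgt = blockOfIter k b.src
    · rw [if_pos h, if_pos (by rw [h])]
    · rw [if_neg h, qsstarG_apply]
      have ht : blockOfIter k b.tgt = (blockOfIter k b.src).shift b.dir :=
        (blockOfIter_shift k (by omega) b.src b.dir).resolve_left h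
      change (if blockOf ((blockOfIter k b.src).shift b.dir) = blockOf (blockOfIter k b.src) then (1 : G) else _) = _
      rw [← ht]

/-- **(4.5.3)**, first case for k-blocks: `(Q^{s*}_kV)(b) = 1` for `b` strictly inside a k-block (standing range).
[cite: BalabanImbrieJaffe1985, (4.5.3) p.312] -/
theorem qsstarGIter_of_interior [One G] {k : ℕ} (hk : i + k ≤ P.m + P.K) (V : GaugeField P (i + k) G) {b : PBond P i}
    (hb : blockOfIter k b.src = blockOfIter k b.tgt) : qsstarGIter k V b = 1 := by
  rw [qsstarGIter_eq k hk, if_pos hb.symm]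

/-- **(4.5.3)**, second case for k-blocks: `(Q^{s*}_kV)(b) = V(c)` for `b` in the corridor `B^s_k(c)` between `B^k(c₋)` and `B^k(c₊)`
(`BIJ85Eq224Proof.torusBlockBondsIter`; standing range). [cite: BalabanImbrieJaffe1985, (4.5.3) p.312] -/
theorem qsstarGIter_of_mem [One G] {k : ℕ} (hk : i + k ≤ P.m + P.K) (V : GaugeField P (i + k) G) {b : PBond P i}
    {c : PBond P (i + k)} (h : b ∈ (torusBlockBondsIter P i k).Bs c) : qsstarGIter k V b = V c := by
  have hc := barBond_eq_of_mem hk h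
  rw [mem_BsIter_iff] at h
  have hne : blockOfIter k b.tgt ≠ blockOfIter k b.src := by
    rw [h.1, h.2]
    exact shift_ne_self c.src c.dir
  rw [qsstarGIter_eq k hk, if_neg hne, ← hc]

/-- **`(Q^{s*}_kV)(∂p) = V(∂p′)` for `p ∈ B^e_k(p′)`** (k-fold edge set `BIJ85Eq224ProofPart2.torusEdgeCellsIter`), any gauge group; induction
on `k` through the nesting `B^e_{k+1}(p′) = ⋃_{p̄∈B^e(p′)} B^e_k(p̄)` (standing range, `2 ≤ d`). [cite: BalabanImbrieJaffe1985, (4.5.3) p.312] -/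
theorem plaqHol_qsstarGIter_of_mem [GaugeGroup G] (hd : 2 ≤ P.d) : ∀ (k : ℕ), i + k ≤ P.m + P.K → ∀ (V : GaugeField P (i + k) G)
    {p : Plaq P i} {p' : Plaq P (i + k)}, p ∈ (torusEdgeCellsIter P i k hd).B p' →
      GaugeField.plaqHol (qsstarGIter k V) p = GaugeField.plaqHol V p'
  | 0, _, V, p, p', h => by
    rw [edgeBIter_zero, Finset.mem_singleton] at h
    subst h
    rfl
  | k + 1, hk, V, p, p', h => by
    obtain ⟨h1, h2⟩ := (mem_edgeBIter_succ_iff hk hd p' p).mp h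
    rw [qsstarGIter_succ, plaqHol_qsstarGIter_of_mem hd k (by omega) (qsstarG V) h2,
      plaqHol_qsstarG_of_mem (by omega : i + k + 1 ≤ P.m + P.K) hd V h1]

/-- … and `(Q^{s*}_kV)(∂p) = 1` off the k-fold edge plaquettes (standing range, `2 ≤ d`). [cite: BalabanImbrieJaffe1985, (4.5.3) p.312] -/
theorem plaqHol_qsstarGIter_of_not_mem [GaugeGroup G] (hd : 2 ≤ P.d) : ∀ (k : ℕ), i + k ≤ P.m + P.K →
    ∀ (V : GaugeField P (i + k) G) {p : Plaq P i}, (∀ p', p ∉ (torusEdgeCellsIter P i k hd).B p') →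
      GaugeField.plaqHol (qsstarGIter k V) p = 1
  | 0, _, V, p, h => absurd (by rw [edgeBIter_zero]; exact Finset.mem_singleton_self p) (h p)
  | k + 1, hk, V, p, h => by
    rw [qsstarGIter_succ]
    by_cases hp : ∃ p₁, p ∈ (torusEdgeCellsIter P i k hd).B p₁
    · obtain ⟨p₁, h₁⟩ := hp
      rw [plaqHol_qsstarGIter_of_mem hd k (by omega) (qsstarG V) h₁]
      refine plaqHol_qsstarG_of_not_mem (by omega : i + k + 1 ≤ P.m + P.K) hd V fun p' h' => h p' ?_
      rw [mem_edgeBIter_succ_iff hk hd, ← barPlaq_eq_of_mem hd h₁]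
      exact ⟨h', h₁⟩
    · push Not at hp
      exact plaqHol_qsstarGIter_of_not_mem hd k (by omega) (qsstarG V) hp

/-! ## 4. The U(1) dictionary: (4.5.2) is (4.5.3) -/

/-- **(4.5.2) = (4.5.3)** for U(1), one step: for `v = exp(ieB)` on `T^{(j+1)}` and `ηL = 1`, the Lie-algebra pull-back exponentiated,
`exp(ieη(Q^{s*}B)_b)` (`expField (eη) (Q^{s*}B)`; values `BlockBonds.QsstarGroup`), IS `(Q^{s*}v)_b` of (4.5.3) — *"The independence of the
resulting transformation on this choice [of the branch] follows from the equivalent definition"* (standing range).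
[cite: BalabanImbrieJaffe1985, (4.5.2) p.312] -/
theorem expField_Qsstar_eq_qsstarG (hj : j + 1 ≤ P.m + P.K) (e η : ℝ) (hη : η * (P.L : ℝ) = 1) (B : PBond P (j + 1) → ℝ)
    (b : PBond P j) : expField (e * η) ((torusBlockBonds P j).Qsstar B) b = qsstarG (expField e B) b := by
  by_cases hb : blockOf b.tgt = blockOf b.src
  · rw [qsstarG_of_interior _ hb.symm, expField, (torusBlockBonds P j).Qsstar_of_not_mem B
      ((torusBlockBonds P j).not_mem_Bs_of_interior hb.symm), mul_zero, Circle.exp_zero]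
  · have hmem := mem_Bs_of_not_interior hj hb
    rw [qsstarG_of_mem hj _ hmem, expField, expField, (torusBlockBonds P j).Qsstar_of_mem B hmem]
    congr 1
    change e * η * ((P.L : ℝ) * B ⟨blockOf b.src, b.dir⟩) = e * B ⟨blockOf b.src, b.dir⟩
    calc e * η * ((P.L : ℝ) * B ⟨blockOf b.src, b.dir⟩) = e * (η * (P.L : ℝ)) * B ⟨blockOf b.src, b.dir⟩ := by ring
      _ = e * B ⟨blockOf b.src, b.dir⟩ := by rw [hη, mul_one]

/-- **(4.5.2) = (4.5.3)** for U(1), k-fold: `exp(ie_kη(Q^{s*}_kB)_b) = (Q^{s*}_kv)_b` with `v = exp(ie_kB)` on the unit lattice `T^{(i+k)}`,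
`ηL^k = 1`, `Q^{s*}_k` = `BlockBonds.Qsstar` of `torusBlockBondsIter` on the left and the group-valued composite `qsstarGIter k` on the right
(standing range). [cite: BalabanImbrieJaffe1985, (4.5.2) p.312] -/
theorem expField_QsstarIter_eq_qsstarGIter {k : ℕ} (hk : i + k ≤ P.m + P.K) (e η : ℝ) (hη : η * (P.L : ℝ) ^ k = 1)
    (B : PBond P (i + k) → ℝ) (b : PBond P i) :
    expField (e * η) ((torusBlockBondsIter P i k).Qsstar B) b = qsstarGIter k (expField e B) b := by
  by_cases hb : blockOfIter k b.tgt = blockOfIter k b.src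
  · have hnot : ∀ c, b ∉ (torusBlockBondsIter P i k).Bs c := fun c hc => by
      rw [mem_BsIter_iff] at hc
      exact shift_ne_self c.src c.dir (hc.2.symm.trans (hb.trans hc.1))
    rw [qsstarGIter_of_interior hk _ hb.symm, expField, (torusBlockBondsIter P i k).Qsstar_of_not_mem B hnot, mul_zero,
      Circle.exp_zero]
  · have ht : blockOfIter k b.tgt = (blockOfIter k b.src).shift b.dir := (blockOfIter_shift k hk b.src b.dir).resolve_left hb
    have hmem : b ∈ (torusBlockBondsIter P i k).Bs ⟨blockOfIter k b.src, b.dir⟩ := by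
      rw [mem_BsIter_iff]
      exact ⟨rfl, ht⟩
    rw [qsstarGIter_of_mem hk _ hmem, expField, expField, (torusBlockBondsIter P i k).Qsstar_of_mem B hmem]
    congr 1
    change e * η * (((P.L ^ k : ℕ) : ℝ) * B ⟨blockOfIter k b.src, b.dir⟩) = e * B ⟨blockOfIter k b.src, b.dir⟩
    rw [Nat.cast_pow]
    calc e * η * ((P.L : ℝ) ^ k * B ⟨blockOfIter k b.src, b.dir⟩) = e * (η * (P.L : ℝ) ^ k) * B ⟨blockOfIter k b.src, b.dir⟩ := by ring
      _ = e * B ⟨blockOfIter k b.src, b.dir⟩ := by rw [hη, mul_one]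

/-! ## 5. The pull-back is a section of the straight-line average: `M(Q^{s*}V) = V` -/

/-- kernel: the values of `Q^{s*}V` along the straight line of the coarse bond `c` (the `L` bonds `AveragingRT.line c t` from the centre of
`B(c₋)` to the centre of `B(c₊)`): the middle bond `t = (L−1)/2` is the line's only corridor bond and carries `V(c)`, all others lie
inside `B(c₋)` or `B(c₊)` and carry `1` (standing range). [cite: BalabanImbrieJaffe1985, (4.5.3) p.312] -/
theorem qsstarG_line [One G] (hj : j + 1 ≤ P.m + P.K) (V : GaugeField P (j + 1) G) (c : PBond P (j + 1)) {t : ℕ} (ht : t < P.L) :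
    qsstarG V (AveragingRT.line c t) = if t = (P.L - 1) / 2 then V c else 1 := by
  have hL := P.hL.2
  have hne : c.tgt ≠ c.src := shift_ne_self c.src c.dir
  have hsrc_lo : t ≤ (P.L - 1) / 2 → blockOf (AveragingRT.line c t).src = c.src := fun h => by
    change blockOf (AveragingRT.lineSite c t) = _
    rw [AveragingRT.lineSite_eq_lo hj c h, Balaban1983to89.Site.blockOf_blockSite hj]
  have hsrc_hi : (P.L - 1) / 2 < t → blockOf (AveragingRT.line c t).src = c.tgt := fun h => by
    change blockOf (AveragingRT.lineSite c t) = _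
    rw [AveragingRT.lineSite_eq_hi hj c h ht.le, Balaban1983to89.Site.blockOf_blockSite hj]
  have htgt_lo : t + 1 ≤ (P.L - 1) / 2 → blockOf (AveragingRT.line c t).tgt = c.src := fun h => by
    change blockOf ((AveragingRT.lineSite c t).shift c.dir) = _
    rw [← AveragingRT.lineSite_succ, AveragingRT.lineSite_eq_lo hj c h, Balaban1983to89.Site.blockOf_blockSite hj]
  have htgt_hi : (P.L - 1) / 2 < t + 1 → blockOf (AveragingRT.line c t).tgt = c.tgt := fun h => by
    change blockOf ((AveragingRT.lineSite c t).shift c.dir) = _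
    rw [← AveragingRT.lineSite_succ, AveragingRT.lineSite_eq_hi hj c h (by omega), Balaban1983to89.Site.blockOf_blockSite hj]
  rw [qsstarG_apply]
  by_cases h : t = (P.L - 1) / 2
  · rw [if_pos h, hsrc_lo h.le, htgt_hi (by omega), if_neg hne]
    rfl
  · rw [if_neg h]
    by_cases h1 : (P.L - 1) / 2 < t
    · rw [hsrc_hi h1, htgt_hi (by omega), if_pos rfl]
    · rw [hsrc_lo (by omega), htgt_lo (by omega), if_pos rfl]

/-- kernel: the partial transports of `Q^{s*}V` along the line of `c`: `1` before the corridor bond, `V(c)` from it on (standing range).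
[cite: BalabanImbrieJaffe1985, (4.5.3) p.312] -/
theorem pathProd_qsstarG [GaugeGroup G] (hj : j + 1 ≤ P.m + P.K) (V : GaugeField P (j + 1) G) (c : PBond P (j + 1)) :
    ∀ n, n ≤ P.L → AveragingRT.pathProd (qsstarG V) c n = if (P.L - 1) / 2 < n then V c else 1
  | 0, _ => by simp [AveragingRT.pathProd]
  | n + 1, hn => by
    rw [AveragingRT.pathProd, pathProd_qsstarG hj V c n (by omega), qsstarG_line hj V c (by omega)]
    by_cases h : (P.L - 1) / 2 < n
    · rw [if_pos h, if_neg (by omega), if_pos (by omega), mul_one]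
    · rw [if_neg h]
      by_cases h' : n = (P.L - 1) / 2
      · rw [if_pos h', if_pos (by omega), one_mul]
      · rw [if_neg h', if_neg (by omega), one_mul]

/-- **`M(Q^{s*}V) = V`**: the pull-back (4.5.3) is a SECTION of the straight-line (decimation) average of the series' tori
(`Balaban1983to89.AveragingRT.axialAvg`, the transport along the centre-to-centre line — the one-contour case of [Balaban1985Averaging]
(15)): averaging the pulled-back configuration returns `V`, for any gauge group — the group-valued counterpart, for this average, of
*"QQ^{s*} = I"* (2.19) p. 305 (standing range). [cite: BalabanImbrieJaffe1985, (2.19) p.305] -/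
theorem axialAvg_qsstarG [GaugeGroup G] (hj : j + 1 ≤ P.m + P.K) (V : GaugeField P (j + 1) G) :
    AveragingRT.axialAvg (qsstarG V) = V := by
  funext c
  rw [AveragingRT.axialAvg, pathProd_qsstarG hj V c P.L le_rfl, if_pos (AveragingRT.half_lt P)]

/-- `Q^{s*}_k` FROM THE UNIT LATTICE `T^{(k)}` TO THE FINEST TORUS `T^{(0)}` as the k-fold composite (the indexing of `Setup.Averaging.iter`:
source level `k`, target level `0`). [cite: BalabanImbrieJaffe1985, (4.5.3) p.312] -/
def qsstarGIter0 [One G] : (k : ℕ) → GaugeField P k G → GaugeField P 0 G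
  | 0 => id
  | k + 1 => fun V => qsstarGIter0 k (qsstarG V)

/-- `Q^{s*}_0 = I` (base-0 indexing). [cite: BalabanImbrieJaffe1985, (4.5.3) p.312] -/
@[simp] theorem qsstarGIter0_zero [One G] (V : GaugeField P 0 G) : qsstarGIter0 0 V = V := rfl

/-- `Q^{s*}_{k+1}V = Q^{s*}_k(Q^{s*}V)` (base-0 indexing). [cite: BalabanImbrieJaffe1985, (4.5.3) p.312] -/
theorem qsstarGIter0_succ [One G] (k : ℕ) (V : GaugeField P (k + 1) G) : qsstarGIter0 (k + 1) V = qsstarGIter0 k (qsstarG V) := rfl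

/-- **`M^k(Q^{s*}_kV) = V`**: the k-fold pull-back is a section of the k-fold straight-line average `Setup.Averaging.iter` of the axial
averaging `AveragingRT.axial` — the configuration `Q^{s*}_kV` has the prescribed k-fold averages `V` (the rôle in which
[Balaban1988Convergent] (1.2)–(1.3) and the later papers use it), for any gauge group (standing range `k ≤ m + K`).
[cite: BalabanImbrieJaffe1985, (2.19) p.305] -/
theorem iter_axial_qsstarGIter0 [GaugeGroup G] : ∀ (k : ℕ), k ≤ P.m + P.K → ∀ V : GaugeField P k G,
    Averaging.iter (fun j => (AveragingRT.axial : Averaging P j G)) k (qsstarGIter0 k V) = V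
  | 0, _, V => rfl
  | k + 1, hk, V => by
    rw [qsstarGIter0_succ]
    change AveragingRT.axialAvg (Averaging.iter (fun j => (AveragingRT.axial : Averaging P j G)) k (qsstarGIter0 k (qsstarG V))) = V
    rw [iter_axial_qsstarGIter0 k (by omega) (qsstarG V), axialAvg_qsstarG hk V]

/-! ## 6. Gauge covariance of the pull-back: `Q^{s*}(V^g) = (Q^{s*}V)^{g∘B}` -/

/-- GAUGE COVARIANCE of (4.5.3): transforming the unit-lattice field by a gauge function `g` (`V^g(c) = g(c₋)V(c)g(c₊)⁻¹`,
`Setup.GaugeField.gaugeAct`) transforms the pull-back by the BLOCK-CONSTANT gauge function `g ∘ blockOf` on the fine torus — the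
mechanism by which block-field gauge transformations are induced on the background fields built from `Q^{s*}_k` ([BalabanImbrieJaffe1988]
(4.16)–(4.17) p. 277; the δ-function side is reader r18's `BIJ88BlockGauge417`), any gauge group (standing range).
[cite: BalabanImbrieJaffe1988, (4.17) p.277] -/
theorem qsstarG_gaugeAct [GaugeGroup G] (hj : j + 1 ≤ P.m + P.K) (g : GaugeTransf P (j + 1) G) (V : GaugeField P (j + 1) G) :
    qsstarG (GaugeField.gaugeAct g V) = GaugeField.gaugeAct (fun x => g (blockOf x)) (qsstarG V) := by
  funext b
  by_cases hb : blockOf b.tgt = blockOf b.src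
  · rw [qsstarG_of_interior _ hb.symm, GaugeField.gaugeAct, qsstarG_of_interior _ hb.symm, hb, mul_one, mul_inv_cancel]
  · have hmem := mem_Bs_of_not_interior hj hb
    have ht : blockOf b.tgt = (blockOf b.src).shift b.dir := ((mem_Bs_iff _ _).mp hmem).2
    rw [qsstarG_of_mem hj _ hmem, GaugeField.gaugeAct, GaugeField.gaugeAct, qsstarG_of_mem hj _ hmem, ht]
    rfl

/-- Gauge covariance of the k-fold pull-back: `Q^{s*}_k(V^g) = (Q^{s*}_kV)^{g∘B^k}` with the k-fold block map `blockOfIter k` (standing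
range). [cite: BalabanImbrieJaffe1988, (4.17) p.277] -/
theorem qsstarGIter_gaugeAct [GaugeGroup G] : ∀ (k : ℕ), i + k ≤ P.m + P.K → ∀ (g : GaugeTransf P (i + k) G) (V : GaugeField P (i + k) G),
    qsstarGIter k (GaugeField.gaugeAct g V) = GaugeField.gaugeAct (fun x => g (blockOfIter k x)) (qsstarGIter k V)
  | 0, _, _, _ => rfl
  | k + 1, hk, g, V => by
    rw [qsstarGIter_succ, qsstarGIter_succ, qsstarG_gaugeAct hk g V, qsstarGIter_gaugeAct k (by omega)]
    rfl

end Literature.MathematicalPhysics.QuantumFieldTheory.BalabanImbrieJaffe1984to88.BIJ85Eq453GaugeField
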